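import Summits.Ventures.PercRepro.PlaneWeightingB

/-!
# PercRepro — Theorem O, piece (O5): the per-plane closing and Step 2 of `(5, 3)` (p2, gen 5)

`proofs/MINE2-RLS.md` §16 Step 2 with the CRUDE bounds (rank ≤ size, submodularity) in place of the hyperplane /
skew-pair analysis: for a simple matroid with `ρ(E) ≥ 5`, coloop-free when `ρ(E) = 5`, and a plane `G` with
`n′ := |E ∖ G|`, `T / LP / R :=` the numbers of `B′ ∈ N₃(G)` with `|B′| = 3` / with a tie line / with neither,
`g′ := #{a ∈ G : ρ(G ∖ {a}) = 3}`:

* `ρ(E ∖ G) ≥ 5` — `#U′_G ≤ N₃` and `n′ ≥ 5`, closed by `T/4 + LP/2 + R ≥ N₃/4`;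
* `ρ(E ∖ G) = 4` — `G ∉ U′_G`, `n′ ≥ 4`, closed by **(α)** `T ≤ 3·LP + 11·R + 5`;
* `ρ(E ∖ G) ≤ 3` — `G` and every `G ∖ {a}` are outside `U′_G`, `n′ ≥ 3` (coloop-freeness when `ρ(E ∖ G) = 2`),
  closed by **(β)** `2·T ≤ LP + 7·R + 5 + 5·g′`.

(α) and (β) are Step 3's inequalities on the line structure of a simple plane (`hαβ`); with them
`phi53_mul_card_U_le` is `Φ(5, 3)·#U′ ≤ #Y` (`Φ(5, 3) = 5/4`).  Imports Mathlib, `RankLevelSetHCore`, `PlaneCore`,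
`PlaneWeighting`.
-/

namespace PercRepro

namespace ThmO

open Finset ThmH

variable {α : Type*} [DecidableEq α] {M : Matroid α} [M.Finite]

/-! ### The three counts of a plane -/

open scoped Classical in
/-- `T(G)`: the independent triples of `G`. -/
noncomputable def Tc (M : Matroid α) [M.Finite] (G : Finset α) : ℕ := ((N3 M G).filter (fun B => B.card = 3)).card

open scoped Classical in
/-- `LP(G)`: the rank-3 subsets with at least four points and a tie line. -/
noncomputable def LPc (M : Matroid α) [M.Finite] (G : Finset α) : ℕ :=
  ((N3 M G).filter (fun B => ¬ B.card = 3 ∧ (tieLines M G B).Nonempty)).card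

open scoped Classical in
/-- `R(G)`: the rank-3 subsets with at least four points and no tie line. -/
noncomputable def Rc (M : Matroid α) [M.Finite] (G : Finset α) : ℕ :=
  ((N3 M G).filter (fun B => ¬ B.card = 3 ∧ ¬ (tieLines M G B).Nonempty)).card

open scoped Classical in
/-- `g′(G)`: the points `a` of `G` with `ρ(G ∖ {a}) = 3`. -/
noncomputable def gp (M : Matroid α) [M.Finite] (G : Finset α) : ℕ :=
  (G.filter (fun a => M.eRk ((G.erase a : Finset α) : Set α) = 3)).card

/-- `N₃ = T + LP + R`. -/
theorem card_N3_eq (M : Matroid α) [M.Finite] (G : Finset α) : (N3 M G).card = Tc M G + LPc M G + Rc M G := by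
  classical
  unfold Tc LPc Rc
  have h1 := Finset.card_filter_add_card_filter_not (s := N3 M G) (fun B => B.card = 3)
  have h2 := Finset.card_filter_add_card_filter_not (s := (N3 M G).filter (fun B => ¬ B.card = 3))
    (fun B => (tieLines M G B).Nonempty)
  rw [Finset.filter_filter, Finset.filter_filter] at h2
  omega

/-- `Σ_{B′ ∈ N₃(G)} wt(B′) = T/4 + LP/2 + R`. -/
theorem sum_wt_eq (M : Matroid α) [M.Finite] (G : Finset α) :
    ∑ B ∈ N3 M G, wt M G B = (Tc M G : ℚ) / 4 + (LPc M G : ℚ) / 2 + (Rc M G : ℚ) := by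
  classical
  unfold Tc LPc Rc wt
  rw [Finset.sum_ite, Finset.sum_ite, Finset.sum_const, Finset.sum_const, Finset.sum_const,
    Finset.filter_filter, Finset.filter_filter]
  simp only [nsmul_eq_mul, mul_one]
  ring

/-! ### The crude rank bounds for a plane -/

/-- `ρ(E) ≤ ρ(E ∖ G) + 3` for a plane `G`. -/
theorem eRank_le_eRk_sdiff_add_three {G : Finset α} (hG : G ∈ planes M) :
    M.eRank ≤ M.eRk ((gr M \ G : Finset α) : Set α) + 3 := by
  have hGE := (mem_planes.1 hG).1
  have hsplit : gr M = (gr M \ G) ∪ G := (Finset.sdiff_union_of_subset hGE).symm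
  have h := M.eRk_union_le_eRk_add_eRk ((gr M \ G : Finset α) : Set α) (G : Set α)
  rw [← Finset.coe_union, ← hsplit, coe_gr, M.eRk_ground, (mem_planes.1 hG).2.2] at h
  exact h

/-- For `B′ ⊆ G`: `ρ(E ∖ B′) ≤ ρ(E ∖ G) + |G ∖ B′|`. -/
theorem eRk_sdiff_le {G B : Finset α} (hG : G ∈ planes M) (hB : B ⊆ G) :
    M.eRk ((gr M \ B : Finset α) : Set α) ≤ M.eRk ((gr M \ G : Finset α) : Set α) + ((G \ B).card : ℕ∞) := by
  have hGE := (mem_planes.1 hG).1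
  have hsplit : gr M \ B = (gr M \ G) ∪ (G \ B) := (Finset.sdiff_union_sdiff_cancel hGE hB).symm
  have h := M.eRk_union_le_eRk_add_eRk ((gr M \ G : Finset α) : Set α) ((G \ B : Finset α) : Set α)
  rw [← Finset.coe_union, ← hsplit] at h
  refine h.trans (add_le_add (le_refl _) ?_)
  have := M.eRk_le_encard ((G \ B : Finset α) : Set α)
  rwa [Set.encard_coe_eq_coe_finsetCard] at this

/-- A member of `U′_G` with `ρ(E ∖ G) = k` has `5 ≤ k + |G ∖ B′|`. -/
theorem five_le_of_mem_UG {G B : Finset α} (hG : G ∈ planes M) (hB : B ∈ UG M G) {k : ℕ}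
    (hk : M.eRk ((gr M \ G : Finset α) : Set α) = k) : 5 ≤ k + (G \ B).card := by
  simp only [UG, Finset.mem_filter, Finset.mem_powerset] at hB
  obtain ⟨hBG, -, h5⟩ := hB
  have := h5.trans (eRk_sdiff_le hG hBG)
  rw [hk] at this
  have h' : ((5 : ℕ) : ℕ∞) ≤ ((k + (G \ B).card : ℕ) : ℕ∞) := by push_cast; exact this
  exact_mod_cast h'

/-- `U′_G ⊆ N₃(G)`. -/
theorem UG_subset_N3 (M : Matroid α) [M.Finite] (G : Finset α) : UG M G ⊆ N3 M G := by
  intro B hB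
  simp only [UG, N3, Finset.mem_filter, Finset.mem_powerset] at hB ⊢
  exact ⟨hB.1, hB.2.1⟩

omit [DecidableEq α] in
/-- `G ∈ N₃(G)`. -/
theorem self_mem_N3 {G : Finset α} (hG : G ∈ planes M) : G ∈ N3 M G := by
  simp only [N3, Finset.mem_filter, Finset.mem_powerset]
  exact ⟨subset_refl _, (mem_planes.1 hG).2.2⟩

/-- When `ρ(E ∖ G) ≤ 4`: `#U′_G + 1 ≤ N₃` (`G` is excluded). -/
theorem card_UG_add_one_le {G : Finset α} (hG : G ∈ planes M) {k : ℕ}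
    (hk : M.eRk ((gr M \ G : Finset α) : Set α) = k) (hk4 : k ≤ 4) :
    (UG M G).card + 1 ≤ (N3 M G).card := by
  have hsub : UG M G ⊆ (N3 M G).erase G := by
    intro B hB
    rw [Finset.mem_erase]
    refine ⟨?_, UG_subset_N3 M G hB⟩
    rintro rfl
    have := five_le_of_mem_UG hG hB hk
    rw [Finset.sdiff_self, Finset.card_empty] at this
    omega
  have := Finset.card_le_card hsub
  rw [Finset.card_erase_of_mem (self_mem_N3 hG)] at this
  have hpos : 1 ≤ (N3 M G).card := Finset.card_pos.2 ⟨G, self_mem_N3 hG⟩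
  omega

/-- When `ρ(E ∖ G) ≤ 3`: `#U′_G + 1 + g′ ≤ N₃` (`G` and the `G ∖ {a}` of rank `3` are excluded). -/
theorem card_UG_add_gp_le {G : Finset α} (hG : G ∈ planes M) {k : ℕ}
    (hk : M.eRk ((gr M \ G : Finset α) : Set α) = k) (hk3 : k ≤ 3) :
    (UG M G).card + 1 + gp M G ≤ (N3 M G).card := by
  classical
  set X : Finset (Finset α) := insert G ((G.filter (fun a => M.eRk ((G.erase a : Finset α) : Set α) = 3)).image
    (fun a => G.erase a)) with hX
  have hXsub : X ⊆ N3 M G := by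
    intro B hB
    rw [hX, Finset.mem_insert, Finset.mem_image] at hB
    rcases hB with rfl | ⟨a, ha, rfl⟩
    · exact self_mem_N3 hG
    · rw [Finset.mem_filter] at ha
      simp only [N3, Finset.mem_filter, Finset.mem_powerset]
      exact ⟨Finset.erase_subset _ _, ha.2⟩
  have hinj : Set.InjOn (fun a => G.erase a) ↑(G.filter (fun a => M.eRk ((G.erase a : Finset α) : Set α) = 3)) := by
    intro a ha b hb hab
    simp only at hab
    rw [Finset.mem_coe, Finset.mem_filter] at ha hb
    by_contra hne
    have : a ∈ G.erase b := Finset.mem_erase.2 ⟨hne, ha.1⟩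
    rw [← hab, Finset.mem_erase] at this
    exact this.1 rfl
  have hnot : G ∉ (G.filter (fun a => M.eRk ((G.erase a : Finset α) : Set α) = 3)).image (fun a => G.erase a) := by
    rw [Finset.mem_image]
    rintro ⟨a, ha, hGa⟩
    rw [Finset.mem_filter] at ha
    have := Finset.card_erase_of_mem ha.1
    rw [hGa] at this
    have hpos : 0 < G.card := Finset.card_pos.2 ⟨a, ha.1⟩
    omega
  have hXcard : X.card = 1 + gp M G := by
    rw [hX, Finset.card_insert_of_notMem hnot, Finset.card_image_of_injOn hinj, gp]
    ring
  have hsub : UG M G ⊆ N3 M G \ X := by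
    intro B hB
    rw [Finset.mem_sdiff]
    refine ⟨UG_subset_N3 M G hB, ?_⟩
    intro hBX
    have h5 := five_le_of_mem_UG hG hB hk
    rw [hX, Finset.mem_insert, Finset.mem_image] at hBX
    rcases hBX with rfl | ⟨a, ha, rfl⟩
    · rw [Finset.sdiff_self, Finset.card_empty] at h5; omega
    · rw [Finset.mem_filter] at ha
      have : G \ G.erase a = {a} := by
        ext y
        simp only [Finset.mem_sdiff, Finset.mem_erase, Finset.mem_singleton, not_and]
        constructor
        · rintro ⟨hy, h⟩
          by_contra hne
          exact h hne hy
        · rintro rfl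
          exact ⟨ha.1, fun h _ => h rfl⟩
      rw [this, Finset.card_singleton] at h5
      omega
  have := Finset.card_le_card hsub
  rw [Finset.card_sdiff_of_subset hXsub, hXcard] at this
  have := Finset.card_le_card hXsub
  omega

/-- `n′ ≥ 3` for a plane of a simple matroid with `ρ(E) ≥ 5`, coloop-free when `ρ(E) = 5`
(if `n′ = 2` then `ρ(E ∖ G) = 2`, `ρ(E) = 5` and the two points of `E ∖ G` are coloops). -/
theorem three_le_card_sdiff_plane (hpE : (5 : ℕ∞) ≤ M.eRank)
    (hcol : M.eRank = 5 → ∀ e, ¬ M.IsColoop e) {G : Finset α} (hG : G ∈ planes M) :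
    3 ≤ (gr M \ G).card := by
  have hGE := (mem_planes.1 hG).1
  obtain ⟨k, hk, hkn⟩ := eRk_eq_nat M (gr M \ G)
  have h1 := eRank_le_eRk_sdiff_add_three hG
  rw [hk] at h1
  have h1' : ((5 : ℕ) : ℕ∞) ≤ ((k + 3 : ℕ) : ℕ∞) := by push_cast; exact hpE.trans h1
  have h1n : 5 ≤ k + 3 := by exact_mod_cast h1'
  by_contra hcon
  push Not at hcon
  have hk2 : k = 2 := by omega
  have hn : (gr M \ G).card = 2 := by omega
  have hR : M.eRank = 5 := by
    apply le_antisymm _ hpE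
    calc M.eRank ≤ (k : ℕ∞) + 3 := h1
      _ = 5 := by rw [hk2]; norm_num
  obtain ⟨e, he⟩ : ∃ e, e ∈ gr M \ G := Finset.card_pos.1 (by omega)
  apply hcol hR e
  rw [Matroid.isColoop_iff_sdiff_not_spanning, Matroid.spanning_iff_eRk_le Set.sdiff_subset, hR]
  have hsplit : M.E \ {e} = (((gr M \ G).erase e : Finset α) : Set α) ∪ (G : Set α) := by
    rw [← coe_gr M, ← Finset.coe_union, ← Finset.coe_erase]
    congr 1
    ext y
    simp only [Finset.mem_erase, Finset.mem_union, Finset.mem_sdiff]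
    constructor
    · rintro ⟨hye, hy⟩
      by_cases hyG : y ∈ G
      · exact Or.inr hyG
      · exact Or.inl ⟨hye, hy, hyG⟩
    · rintro (⟨hye, hy, -⟩ | hyG)
      · exact ⟨hye, hy⟩
      · refine ⟨?_, hGE hyG⟩
        rintro rfl
        exact (Finset.mem_sdiff.1 he).2 hyG
  have h2 := M.eRk_union_le_eRk_add_eRk ((((gr M \ G).erase e : Finset α)) : Set α) (G : Set α)
  rw [← hsplit, (mem_planes.1 hG).2.2] at h2
  obtain ⟨j, hj, hjn⟩ := eRk_eq_nat M ((gr M \ G).erase e)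
  rw [Finset.card_erase_of_mem he, hn] at hjn
  rw [hj] at h2
  intro hcontra
  have h3 : ((5 : ℕ) : ℕ∞) ≤ ((j + 3 : ℕ) : ℕ∞) := by push_cast; exact hcontra.trans h2
  have h3n : 5 ≤ j + 3 := by exact_mod_cast h3
  omega

/-! ### The per-plane closing and the assembly -/

/-- **(O5) — the per-plane closing**, modulo Step 3's inequalities (α) `T ≤ 3LP + 11R + 5` and
(β) `2T ≤ LP + 7R + 5 + 5g′`: for a simple matroid with `ρ(E) ≥ 5`, coloop-free when `ρ(E) = 5`, every plane
satisfies `(5/4)·#U′_G ≤ |E ∖ G| · Σ_{B′ ∈ N₃(G)} wt(B′)`. -/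
theorem perPlane_closing (hpE : (5 : ℕ∞) ≤ M.eRank) (hcol : M.eRank = 5 → ∀ e, ¬ M.IsColoop e)
    {G : Finset α} (hG : G ∈ planes M)
    (hα : (Tc M G : ℚ) ≤ 3 * LPc M G + 11 * Rc M G + 5)
    (hβ : 2 * (Tc M G : ℚ) ≤ LPc M G + 7 * Rc M G + 5 + 5 * gp M G) :
    (5 / 4 : ℚ) * ((UG M G).card : ℚ) ≤ ((gr M \ G).card : ℚ) * ∑ B ∈ N3 M G, wt M G B := by
  rw [sum_wt_eq]
  have hN := card_N3_eq M G
  have hn3 := three_le_card_sdiff_plane hpE hcol hG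
  obtain ⟨k, hk, hkn⟩ := eRk_eq_nat M (gr M \ G)
  have hUsub : (UG M G).card ≤ (N3 M G).card := Finset.card_le_card (UG_subset_N3 M G)
  have hT0 : (0 : ℚ) ≤ Tc M G := by positivity
  have hL0 : (0 : ℚ) ≤ LPc M G := by positivity
  have hR0 : (0 : ℚ) ≤ Rc M G := by positivity
  have hg0 : (0 : ℚ) ≤ gp M G := by positivity
  rcases lt_or_ge k 4 with hk3 | hk4
  · -- ρ(E ∖ G) ≤ 3: G and the G ∖ {a} are excluded, n′ ≥ 3, (β)
    have hU := card_UG_add_gp_le hG hk (by omega)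
    have hU' : ((UG M G).card : ℚ) + 1 + gp M G ≤ Tc M G + LPc M G + Rc M G := by
      rw [hN] at hU; exact_mod_cast hU
    have hn' : (3 : ℚ) ≤ ((gr M \ G).card : ℚ) := by exact_mod_cast hn3
    have hU0 : (0 : ℚ) ≤ ((UG M G).card : ℚ) := by positivity
    calc (5 / 4 : ℚ) * ((UG M G).card : ℚ) ≤ 3 * ((Tc M G : ℚ) / 4 + (LPc M G : ℚ) / 2 + Rc M G) := by
          nlinarith
      _ ≤ ((gr M \ G).card : ℚ) * ((Tc M G : ℚ) / 4 + (LPc M G : ℚ) / 2 + Rc M G) := by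
          apply mul_le_mul_of_nonneg_right hn'
          positivity
  rcases lt_or_ge k 5 with hk4' | hk5
  · -- ρ(E ∖ G) = 4: G is excluded, n′ ≥ 4, (α)
    have hU := card_UG_add_one_le hG hk (by omega)
    have hU' : ((UG M G).card : ℚ) + 1 ≤ Tc M G + LPc M G + Rc M G := by
      rw [hN] at hU; exact_mod_cast hU
    have hn' : (4 : ℚ) ≤ ((gr M \ G).card : ℚ) := by exact_mod_cast (hk4.trans hkn)
    calc (5 / 4 : ℚ) * ((UG M G).card : ℚ) ≤ 4 * ((Tc M G : ℚ) / 4 + (LPc M G : ℚ) / 2 + Rc M G) := by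
          nlinarith
      _ ≤ ((gr M \ G).card : ℚ) * ((Tc M G : ℚ) / 4 + (LPc M G : ℚ) / 2 + Rc M G) := by
          apply mul_le_mul_of_nonneg_right hn'
          positivity
  · -- ρ(E ∖ G) ≥ 5: n′ ≥ 5 and T/4 + LP/2 + R ≥ N₃/4
    have hU' : ((UG M G).card : ℚ) ≤ Tc M G + LPc M G + Rc M G := by
      rw [hN] at hUsub; exact_mod_cast hUsub
    have hn' : (5 : ℚ) ≤ ((gr M \ G).card : ℚ) := by exact_mod_cast (hk5.trans hkn)
    calc (5 / 4 : ℚ) * ((UG M G).card : ℚ) ≤ 5 * ((Tc M G : ℚ) / 4 + (LPc M G : ℚ) / 2 + Rc M G) := by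
          nlinarith
      _ ≤ ((gr M \ G).card : ℚ) * ((Tc M G : ℚ) / 4 + (LPc M G : ℚ) / 2 + Rc M G) := by
          apply mul_le_mul_of_nonneg_right hn'
          positivity

/-- **Theorem O, Step 2 assembled (finset level)**, modulo Step 3: for a simple matroid with `ρ(E) ≥ 5`,
coloop-free when `ρ(E) = 5`, if every plane satisfies (α) and (β) then `(5/4)·#U′ ≤ #Y`. -/
theorem five_quarter_mul_card_U_le (hpE : (5 : ℕ∞) ≤ M.eRank) (hcol : M.eRank = 5 → ∀ e, ¬ M.IsColoop e)
    (hs : Simple M)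
    (hαβ : ∀ G ∈ planes M, (Tc M G : ℚ) ≤ 3 * LPc M G + 11 * Rc M G + 5 ∧
      2 * (Tc M G : ℚ) ≤ LPc M G + 7 * Rc M G + 5 + 5 * gp M G) :
    (5 / 4 : ℚ) * ((U M).card : ℚ) ≤ ((Y M).card : ℚ) := by
  calc (5 / 4 : ℚ) * ((U M).card : ℚ) ≤ (5 / 4 : ℚ) * ((∑ G ∈ planes M, (UG M G).card : ℕ) : ℚ) := by
        apply mul_le_mul_of_nonneg_left _ (by norm_num)
        exact_mod_cast card_U_le M
    _ = ∑ G ∈ planes M, (5 / 4 : ℚ) * ((UG M G).card : ℚ) := by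
        push_cast
        rw [Finset.mul_sum]
    _ ≤ ∑ G ∈ planes M, ((gr M \ G).card : ℚ) * ∑ B ∈ N3 M G, wt M G B :=
        Finset.sum_le_sum (fun G hG => perPlane_closing hpE hcol hG (hαβ G hG).1 (hαβ G hG).2)
    _ = ∑ G ∈ planes M, ∑ B ∈ N3 M G, ((gr M \ G).card : ℚ) * wt M G B := by
        apply Finset.sum_congr rfl
        intro G _
        rw [Finset.mul_sum]
    _ ≤ ∑ G ∈ planes M, supply M G := Finset.sum_le_sum (fun G hG => supply_ge hs hG)
    _ ≤ ((Y M).card : ℚ) := sum_supply_le M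

end ThmO

end PercRepro
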